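import Mathlib
import Summits.Ventures.HodgeRepro2.Tier7.Line3.DoubleCosetCover

/-!
# Tier7/Line3/CartanDecomposition — the Cartan decomposition of `GL₂` over a discretely valued field

Filer: t7-L1-p3 (gen 9, prover-pub-hodge-repro2-t7-L1-p3-g9-0), self-selected SUPPORT row (TARGET line with the 10-min
window; the «candidate fourth row» of the count-side link, STATUS l. 16131). Lane: Line 3 SUPPORT, [M]-level
consolidation of the split-place row; NOT a line, NOT a device; touches neither residual clause (a′) nor (b′) of the
line.

WHAT IT SUPPLIES. The split-place rows (SplitFactorConstants p711068, CosetEntryBounds p714165, CoverCountLink,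
CoverCountCartan) take the CARTAN REPRESENTATIVES `diag(ϖ^m, ϖ^n)` of the double cosets `K g K`, `K = GL₂(O)`, as given
(«the Cartan parametrisation `K\GL₂(F_w)/K ≅ {(m, n)}` stays in words»). This file proves it — the elementary-divisor
theorem for `2 × 2` matrices over a discretely valued field `(F, v, ϖ)`, `v ϖ = ofAdd (−1)`, by pivoting and elimination:
* F1 the building blocks of `GL₂(O)` as units with EXPLICIT inverses: the swap `!![0, 1; 1, 0]`, the unipotents
  `!![1, 0; x, 1]` / `!![1, x; 0, 1]`, the diagonal `diag(x, y)` (`x, y ≠ 0`);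
* F2 their membership in DoubleCosetCover's `integralSubgroup (v.integer)`: the swap always, the unipotents for `v x ≤ 1`,
  the diagonal for `v x = v y = 1`;
* F3 `exists_unit_mul_zpow` (`x ≠ 0` is `u · ϖ^e` with `v u = 1`); the PIVOT: swaps bring an entry of maximal value to
  the `(0,0)` position (`exists_swap_entry`, `exists_swap_pivot`); the ELIMINATION identity
  `!![a, b; c, d] = lowerMat (c/a) · diag(a, det/a) · upperMat (b/a)` (`a ≠ 0`); `cartan_of_pivot` (with the pivot of
  maximal value, `c/a` and `b/a` are integral, so the unipotents lie in `GL₂(O)`, and `a = u₁ ϖ^m`, `det/a = u₂ ϖ^n`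
  give the diagonal); `exists_cartan` (`det g ≠ 0 ⇒ g = k₁ · diag(ϖ^m, ϖ^n) · k₂`, `k₁, k₂ ∈ GL₂(O)`) and its double-coset
  form `exists_mem_doubleCoset_diag` (`∀ g ∈ GL₂(F), ∃ m n, g ∈ K · diag(ϖ^m, ϖ^n) · K`).
With it the displayed «finite cover of `U` by Cartan double cosets» of CoverCountCartan becomes a theorem of `U` compact
(CoverCountCompact, via DoubleCosetCover's `exists_finset_doubleCoset_cover`). EXISTENCE ONLY (crit-2 l. 16141 (P4)):
no ordering `m ≥ n` and no uniqueness of `(m, n)` is claimed — this is not the invariant-factor theorem; the consumers'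
cost `(1 + |m − n|)²` is symmetric, so nothing is lost.

WHAT STAYS IN WORDS (the dictionary, (a′)): that the real `K_w` IS `GL₂(O_w) = integralSubgroup (v.integer)`; the
displayed datum `hϖ : v ϖ = ofAdd (−1)` is the uniformiser of `F_w` — typed on x1's side for the real place
(InertLevelBase's `valued_uniformizer_eq`, from a uniformiser of `K` at `e = 1`; crit-2 l. 16141 (P5)); the place datum. Nothing here is about (N), (P), the real `X`, or HC_CM. §8(d): NO. Blind lane:
Mathlib + the HodgeRepro2 prefix; no sorry; axioms ⊆ {propext, Classical.choice, Quot.sound}.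
-/

namespace Summit.Ventures.HodgeRepro2.Tier7.Line3.CartanDecomposition

open Matrix Summit.Ventures.HodgeRepro2.Tier7.Line3.DoubleCosetCover

/-! ## F1. Building blocks of `GL₂(O)`: swap, lower / upper unipotent, diagonal units -/

section Units

variable {F : Type*} [Field F]

/-- the swap matrix `!![0, 1; 1, 0]`. -/
def swapMat : Matrix (Fin 2) (Fin 2) F := !![0, 1; 1, 0]

/-- the swap matrix is an involution. -/
theorem swapMat_mul_swapMat : (swapMat : Matrix (Fin 2) (Fin 2) F) * swapMat = 1 := by
  simp [swapMat, Matrix.one_fin_two]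

/-- the swap as a unit of `M₂(F)`. -/
def swapUnit : GL (Fin 2) F := ⟨swapMat, swapMat, swapMat_mul_swapMat, swapMat_mul_swapMat⟩

/-- the lower unipotent matrix `!![1, 0; x, 1]`. -/
def lowerMat (x : F) : Matrix (Fin 2) (Fin 2) F := !![1, 0; x, 1]

/-- `!![1, 0; x, 1] · !![1, 0; −x, 1] = 1`. -/
theorem lowerMat_mul_lowerMat_neg (x : F) : lowerMat x * lowerMat (-x) = 1 := by
  simp [lowerMat, Matrix.one_fin_two]

/-- the lower unipotent unit `!![1, 0; x, 1]` (inverse `!![1, 0; −x, 1]`). -/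
def lowerUnit (x : F) : GL (Fin 2) F :=
  ⟨lowerMat x, lowerMat (-x), lowerMat_mul_lowerMat_neg x, by
    simpa using lowerMat_mul_lowerMat_neg (-x)⟩

/-- the upper unipotent matrix `!![1, x; 0, 1]`. -/
def upperMat (x : F) : Matrix (Fin 2) (Fin 2) F := !![1, x; 0, 1]

/-- `!![1, x; 0, 1] · !![1, −x; 0, 1] = 1`. -/
theorem upperMat_mul_upperMat_neg (x : F) : upperMat x * upperMat (-x) = 1 := by
  simp [upperMat, Matrix.one_fin_two]

/-- the upper unipotent unit `!![1, x; 0, 1]` (inverse `!![1, −x; 0, 1]`). -/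
def upperUnit (x : F) : GL (Fin 2) F :=
  ⟨upperMat x, upperMat (-x), upperMat_mul_upperMat_neg x, by
    simpa using upperMat_mul_upperMat_neg (-x)⟩

/-- `diag(x, y) · diag(x⁻¹, y⁻¹) = 1` for `x, y ≠ 0`. -/
theorem diagonal_mul_diagonal_inv (x y : F) (hx : x ≠ 0) (hy : y ≠ 0) :
    (diagonal ![x, y] : Matrix (Fin 2) (Fin 2) F) * diagonal ![x⁻¹, y⁻¹] = 1 := by
  rw [diagonal_mul_diagonal]
  ext i j
  fin_cases i <;> fin_cases j <;> simp [diagonal, hx, hy]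

/-- the diagonal unit `diag(x, y)`, `x, y ≠ 0`. -/
def diagUnit (x y : F) (hx : x ≠ 0) (hy : y ≠ 0) : GL (Fin 2) F :=
  ⟨diagonal ![x, y], diagonal ![x⁻¹, y⁻¹], diagonal_mul_diagonal_inv x y hx hy, by
    simpa using diagonal_mul_diagonal_inv x⁻¹ y⁻¹ (inv_ne_zero hx) (inv_ne_zero hy)⟩

/-- the matrix of the swap unit. -/
@[simp] theorem coe_swapUnit : ((swapUnit : GL (Fin 2) F) : Matrix (Fin 2) (Fin 2) F) = swapMat := rfl
/-- the matrix of the lower unipotent unit. -/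
@[simp] theorem coe_lowerUnit (x : F) : ((lowerUnit x : GL (Fin 2) F) : Matrix (Fin 2) (Fin 2) F) = lowerMat x := rfl
/-- the matrix of the upper unipotent unit. -/
@[simp] theorem coe_upperUnit (x : F) : ((upperUnit x : GL (Fin 2) F) : Matrix (Fin 2) (Fin 2) F) = upperMat x := rfl
/-- the matrix of the diagonal unit. -/
@[simp] theorem coe_diagUnit (x y : F) (hx : x ≠ 0) (hy : y ≠ 0) :
    ((diagUnit x y hx hy : GL (Fin 2) F) : Matrix (Fin 2) (Fin 2) F) = diagonal ![x, y] := rfl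

end Units

/-! ## F2. Membership of the building blocks in `GL₂(O)`, `O = v.integer` -/

section Integral

variable {F : Type*} [Field F] {Γ₀ : Type*} [LinearOrderedCommGroupWithZero Γ₀] (v : Valuation F Γ₀)

/-- the swap lies in `GL₂(O)`. -/
theorem swapUnit_mem : (swapUnit : GL (Fin 2) F) ∈ integralSubgroup v.integer := by
  refine (mem_integralSubgroup _ _).2 ⟨fun i j => ?_, fun i j => ?_⟩ <;>
  · fin_cases i <;> fin_cases j <;> simp [swapUnit, swapMat]

/-- the lower unipotent `!![1, 0; x, 1]` lies in `GL₂(O)` when `v x ≤ 1`. -/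
theorem lowerUnit_mem {x : F} (hx : v x ≤ 1) : lowerUnit x ∈ integralSubgroup v.integer := by
  refine (mem_integralSubgroup _ _).2 ⟨fun i j => ?_, fun i j => ?_⟩ <;>
  · fin_cases i <;> fin_cases j <;> simp [lowerUnit, lowerMat, Valuation.mem_integer_iff, hx]

/-- the upper unipotent `!![1, x; 0, 1]` lies in `GL₂(O)` when `v x ≤ 1`. -/
theorem upperUnit_mem {x : F} (hx : v x ≤ 1) : upperUnit x ∈ integralSubgroup v.integer := by
  refine (mem_integralSubgroup _ _).2 ⟨fun i j => ?_, fun i j => ?_⟩ <;>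
  · fin_cases i <;> fin_cases j <;> simp [upperUnit, upperMat, Valuation.mem_integer_iff, hx]

/-- `diag(x, y)` lies in `GL₂(O)` when `v x = 1 = v y`. -/
theorem diagUnit_mem {x y : F} (hx : x ≠ 0) (hy : y ≠ 0) (hvx : v x = 1) (hvy : v y = 1) :
    diagUnit x y hx hy ∈ integralSubgroup v.integer := by
  refine (mem_integralSubgroup _ _).2 ⟨fun i j => ?_, fun i j => ?_⟩ <;>
  · fin_cases i <;> fin_cases j <;> simp [diagUnit, diagonal, Valuation.mem_integer_iff, hvx, hvy]

end Integral

/-! ## F3. The pivot reduction and the Cartan decomposition -/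

section Cartan

open WithZero Multiplicative

variable {F : Type*} [Field F] (v : Valuation F (WithZero (Multiplicative ℤ))) (ϖ : F)
  (hϖ : v ϖ = ((Multiplicative.ofAdd (-1 : ℤ) : Multiplicative ℤ) : WithZero (Multiplicative ℤ)))

include hϖ in
/-- a uniformiser is non-zero. -/
theorem uniformiser_ne_zero : ϖ ≠ 0 := by
  intro h
  have := hϖ
  rw [h, Valuation.map_zero] at this
  exact WithZero.zero_ne_coe this

include hϖ in
/-- `v (ϖ ^ e) = ofAdd (−e)`. -/
theorem val_zpow (e : ℤ) :
    v (ϖ ^ e) = ((Multiplicative.ofAdd (-e) : Multiplicative ℤ) : WithZero (Multiplicative ℤ)) := by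
  rw [map_zpow₀, hϖ, ← WithZero.coe_zpow, ← ofAdd_zsmul, smul_neg, smul_eq_mul, mul_one]

include hϖ in
/-- **unit times uniformiser power**: every `x ≠ 0` is `u · ϖ ^ e` with `v u = 1`. -/
theorem exists_unit_mul_zpow {x : F} (hx : x ≠ 0) : ∃ (e : ℤ) (u : F), v u = 1 ∧ x = u * ϖ ^ e := by
  have hvx : v x ≠ 0 := (Valuation.ne_zero_iff v).2 hx
  obtain ⟨a, ha⟩ := WithZero.ne_zero_iff_exists.1 hvx
  have hϖ0 : ϖ ≠ 0 := uniformiser_ne_zero v ϖ hϖ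
  refine ⟨-Multiplicative.toAdd a, x / ϖ ^ (-Multiplicative.toAdd a), ?_, ?_⟩
  · rw [Valuation.map_div, val_zpow v ϖ hϖ, neg_neg, ← ha, ofAdd_toAdd, div_self]
    exact WithZero.coe_ne_zero
  · rw [div_mul_cancel₀]
    exact zpow_ne_zero _ hϖ0

/-- `swap · g` lists the rows of `g` in the other order. -/
theorem swapMat_mul (g : Matrix (Fin 2) (Fin 2) F) :
    (swapMat : Matrix (Fin 2) (Fin 2) F) * g = !![g 1 0, g 1 1; g 0 0, g 0 1] := by
  ext i j
  fin_cases i <;> fin_cases j <;> simp [swapMat, Matrix.mul_apply, Fin.sum_univ_two]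

/-- `g · swap` lists the columns of `g` in the other order. -/
theorem mul_swapMat (g : Matrix (Fin 2) (Fin 2) F) :
    g * (swapMat : Matrix (Fin 2) (Fin 2) F) = !![g 0 1, g 0 0; g 1 1, g 1 0] := by
  ext i j
  fin_cases i <;> fin_cases j <;> simp [swapMat, Matrix.mul_apply, Fin.sum_univ_two]

/-- **moving an entry to the pivot position**: for any `(i₀, j₀)` some `s₁, s₂ ∈ {1, swap} ⊆ GL₂(O)` have
`(s₁ g s₂) 0 0 = g i₀ j₀`, and every entry of `s₁ g s₂` is an entry of `g`. -/
theorem exists_swap_entry (g : Matrix (Fin 2) (Fin 2) F) (i₀ j₀ : Fin 2) :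
    ∃ s₁ s₂ : GL (Fin 2) F, s₁ ∈ integralSubgroup v.integer ∧ s₂ ∈ integralSubgroup v.integer ∧
      ((s₁ : Matrix (Fin 2) (Fin 2) F) * g * (s₂ : Matrix (Fin 2) (Fin 2) F)) 0 0 = g i₀ j₀ ∧
      ∀ i j, ∃ i' j', ((s₁ : Matrix (Fin 2) (Fin 2) F) * g * (s₂ : Matrix (Fin 2) (Fin 2) F)) i j = g i' j' := by
  have h1 := (integralSubgroup v.integer).one_mem
  have hs := swapUnit_mem v
  fin_cases i₀ <;> fin_cases j₀
  · refine ⟨1, 1, h1, h1, ?_, fun i j => ?_⟩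
    · simp
    · exact ⟨i, j, by simp⟩
  · refine ⟨1, swapUnit, h1, hs, ?_, fun i j => ?_⟩
    · simp [mul_swapMat]
    · fin_cases i <;> fin_cases j <;> (simp [mul_swapMat]; try exact ⟨_, _, rfl⟩)
  · refine ⟨swapUnit, 1, hs, h1, ?_, fun i j => ?_⟩
    · simp [swapMat_mul]
    · fin_cases i <;> fin_cases j <;> (simp [swapMat_mul]; try exact ⟨_, _, rfl⟩)
  · refine ⟨swapUnit, swapUnit, hs, hs, ?_, fun i j => ?_⟩
    · rw [coe_swapUnit, swapMat_mul, mul_swapMat]; simp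
    · fin_cases i <;> fin_cases j <;> (rw [coe_swapUnit, swapMat_mul, mul_swapMat]; simp; try exact ⟨_, _, rfl⟩)

/-- **the pivot reduction**: some `s₁, s₂ ∈ {1, swap}` (in `GL₂(O)`) bring an entry of maximal value to the `(0,0)`
position of `s₁ g s₂`. -/
theorem exists_swap_pivot (g : Matrix (Fin 2) (Fin 2) F) :
    ∃ s₁ s₂ : GL (Fin 2) F, s₁ ∈ integralSubgroup v.integer ∧ s₂ ∈ integralSubgroup v.integer ∧
      ∀ i j, v (((s₁ : Matrix (Fin 2) (Fin 2) F) * g * (s₂ : Matrix (Fin 2) (Fin 2) F)) i j) ≤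
        v (((s₁ : Matrix (Fin 2) (Fin 2) F) * g * (s₂ : Matrix (Fin 2) (Fin 2) F)) 0 0) := by
  obtain ⟨⟨i₀, j₀⟩, -, hmax⟩ := Finset.exists_max_image (Finset.univ : Finset (Fin 2 × Fin 2))
    (fun p => v (g p.1 p.2)) Finset.univ_nonempty
  have hm : ∀ i j, v (g i j) ≤ v (g i₀ j₀) := fun i j => hmax (i, j) (Finset.mem_univ _)
  obtain ⟨s₁, s₂, hs₁, hs₂, h00, hent⟩ := exists_swap_entry v g i₀ j₀
  refine ⟨s₁, s₂, hs₁, hs₂, fun i j => ?_⟩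
  obtain ⟨i', j', hij⟩ := hent i j
  rw [hij, h00]
  exact hm i' j'

/-- **the elimination identity**: for `a ≠ 0`,
`!![a, b; c, d] = lowerMat (c/a) · diag(a, (a d − b c)/a) · upperMat (b/a)`. -/
theorem eliminate (a b c d : F) (ha : a ≠ 0) :
    (!![a, b; c, d] : Matrix (Fin 2) (Fin 2) F) =
      lowerMat (c / a) * diagonal ![a, (a * d - b * c) / a] * upperMat (b / a) := by
  have hD : (diagonal ![a, (a * d - b * c) / a] : Matrix (Fin 2) (Fin 2) F) =
      !![a, 0; 0, (a * d - b * c) / a] := by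
    ext i j; fin_cases i <;> fin_cases j <;> simp [diagonal]
  rw [hD, lowerMat, upperMat, Matrix.mul_fin_two, Matrix.mul_fin_two]
  ext i j
  fin_cases i <;> fin_cases j
  · simp
  · simp; field_simp
  · simp; field_simp
  · simp; field_simp; ring

include hϖ in
/-- **the Cartan decomposition with a pivot at `(0,0)`**: if `g` has non-zero determinant and `v (g 0 0)` is the maximal
entry value, then `g = k₁ · diag(ϖ^m, ϖ^n) · k₂` with `k₁, k₂ ∈ GL₂(O)`. -/
theorem cartan_of_pivot (g : Matrix (Fin 2) (Fin 2) F) (hdet : g.det ≠ 0)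
    (hmax : ∀ i j, v (g i j) ≤ v (g 0 0)) :
    ∃ (m n : ℤ) (k₁ k₂ : GL (Fin 2) F), k₁ ∈ integralSubgroup v.integer ∧ k₂ ∈ integralSubgroup v.integer ∧
      g = (k₁ : Matrix (Fin 2) (Fin 2) F) * diagonal ![ϖ ^ m, ϖ ^ n] * (k₂ : Matrix (Fin 2) (Fin 2) F) := by
  have hϖ0 : ϖ ≠ 0 := uniformiser_ne_zero v ϖ hϖ
  set a := g 0 0 with ha_def
  set b := g 0 1 with hb_def
  set c := g 1 0 with hc_def
  set d := g 1 1 with hd_def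
  have hg : g = !![a, b; c, d] := (Matrix.etaExpand_eq g).symm
  have hdet' : a * d - b * c ≠ 0 := by rwa [Matrix.det_fin_two] at hdet
  have ha : a ≠ 0 := by
    intro h0
    apply hdet'
    rw [h0, zero_mul, zero_sub, neg_eq_zero]
    have hb0 : v b = 0 := le_antisymm (by simpa [h0] using hmax 0 1) zero_le
    exact mul_eq_zero_of_left ((Valuation.zero_iff v).1 hb0) c
  have hd' : (a * d - b * c) / a ≠ 0 := div_ne_zero hdet' ha
  obtain ⟨m, u₁, hu₁, hau⟩ := exists_unit_mul_zpow v ϖ hϖ ha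
  obtain ⟨n, u₂, hu₂, hdu⟩ := exists_unit_mul_zpow v ϖ hϖ hd'
  have hu₁0 : u₁ ≠ 0 := (Valuation.ne_zero_iff v).1 (by rw [hu₁]; exact one_ne_zero)
  have hu₂0 : u₂ ≠ 0 := (Valuation.ne_zero_iff v).1 (by rw [hu₂]; exact one_ne_zero)
  have hca : v (c / a) ≤ 1 := by
    rw [Valuation.map_div, div_le_one₀ (lt_of_le_of_ne zero_le ((Valuation.ne_zero_iff v).2 ha).symm)]
    exact hmax 1 0
  have hba : v (b / a) ≤ 1 := by
    rw [Valuation.map_div, div_le_one₀ (lt_of_le_of_ne zero_le ((Valuation.ne_zero_iff v).2 ha).symm)]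
    exact hmax 0 1
  refine ⟨m, n, lowerUnit (c / a) * diagUnit u₁ u₂ hu₁0 hu₂0, upperUnit (b / a),
    (integralSubgroup v.integer).mul_mem (lowerUnit_mem v hca) (diagUnit_mem v hu₁0 hu₂0 hu₁ hu₂),
    upperUnit_mem v hba, ?_⟩
  rw [Units.val_mul, coe_lowerUnit, coe_diagUnit, coe_upperUnit, hg, eliminate a b c d ha]
  have hdd : (diagonal ![u₁, u₂] : Matrix (Fin 2) (Fin 2) F) * diagonal ![ϖ ^ m, ϖ ^ n] =
      diagonal ![a, (a * d - b * c) / a] := by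
    rw [diagonal_mul_diagonal]
    congr 1
    ext i
    fin_cases i
    · simp [hau]
    · simp [hdu]
  rw [Matrix.mul_assoc (lowerMat (c / a)) (diagonal ![u₁, u₂]) (diagonal ![ϖ ^ m, ϖ ^ n]), hdd]

include hϖ in
/-- **THE CARTAN DECOMPOSITION OF `GL₂` OVER A DISCRETELY VALUED FIELD**: every `g` with `det g ≠ 0` is
`k₁ · diag(ϖ^m, ϖ^n) · k₂` with `k₁, k₂ ∈ GL₂(O)`, `O = {x | v x ≤ 1}` (elementary divisors by pivoting and
elimination). -/
theorem exists_cartan (g : Matrix (Fin 2) (Fin 2) F) (hdet : g.det ≠ 0) :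
    ∃ (m n : ℤ) (k₁ k₂ : GL (Fin 2) F), k₁ ∈ integralSubgroup v.integer ∧ k₂ ∈ integralSubgroup v.integer ∧
      g = (k₁ : Matrix (Fin 2) (Fin 2) F) * diagonal ![ϖ ^ m, ϖ ^ n] * (k₂ : Matrix (Fin 2) (Fin 2) F) := by
  obtain ⟨s₁, s₂, hs₁, hs₂, hmax⟩ := exists_swap_pivot v g
  have hdet' : ((s₁ : Matrix (Fin 2) (Fin 2) F) * g * (s₂ : Matrix (Fin 2) (Fin 2) F)).det ≠ 0 := by
    rw [Matrix.det_mul, Matrix.det_mul]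
    exact mul_ne_zero (mul_ne_zero (Matrix.GeneralLinearGroup.det_ne_zero s₁) hdet)
      (Matrix.GeneralLinearGroup.det_ne_zero s₂)
  obtain ⟨m, n, k₁, k₂, hk₁, hk₂, hfac⟩ := cartan_of_pivot v ϖ hϖ _ hdet' hmax
  refine ⟨m, n, s₁⁻¹ * k₁, k₂ * s₂⁻¹, (integralSubgroup v.integer).mul_mem
    ((integralSubgroup v.integer).inv_mem hs₁) hk₁,
    (integralSubgroup v.integer).mul_mem hk₂ ((integralSubgroup v.integer).inv_mem hs₂), ?_⟩
  have e1 : g = ((s₁⁻¹ : GL (Fin 2) F) : Matrix (Fin 2) (Fin 2) F) *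
      ((s₁ : Matrix (Fin 2) (Fin 2) F) * g * (s₂ : Matrix (Fin 2) (Fin 2) F)) *
      ((s₂⁻¹ : GL (Fin 2) F) : Matrix (Fin 2) (Fin 2) F) := by
    rw [← Matrix.mul_assoc, ← Matrix.mul_assoc, ← Units.val_mul, inv_mul_cancel, Units.val_one, Matrix.one_mul,
      Matrix.mul_assoc, ← Units.val_mul, mul_inv_cancel, Units.val_one, Matrix.mul_one]
  rw [Units.val_mul, Units.val_mul]
  calc g = _ := e1
    _ = _ := by rw [hfac]; simp only [Matrix.mul_assoc]

include hϖ in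
/-- **THE CARTAN DECOMPOSITION, DOUBLE-COSET FORM**: every `g ∈ GL₂(F)` lies in the double coset
`K · diag(ϖ^m, ϖ^n) · K`, `K = GL₂(O)`, for some `m, n : ℤ` (`D` the diagonal unit). -/
theorem exists_mem_doubleCoset_diag (g : GL (Fin 2) F) :
    ∃ (m n : ℤ) (D : GL (Fin 2) F), (D : Matrix (Fin 2) (Fin 2) F) = diagonal ![ϖ ^ m, ϖ ^ n] ∧
      g ∈ DoubleCoset.doubleCoset D (integralSubgroup v.integer : Set (GL (Fin 2) F))
        (integralSubgroup v.integer) := by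
  have hϖ0 : ϖ ≠ 0 := uniformiser_ne_zero v ϖ hϖ
  obtain ⟨m, n, k₁, k₂, hk₁, hk₂, hfac⟩ :=
    exists_cartan v ϖ hϖ (g : Matrix (Fin 2) (Fin 2) F) (Matrix.GeneralLinearGroup.det_ne_zero g)
  refine ⟨m, n, diagUnit (ϖ ^ m) (ϖ ^ n) (zpow_ne_zero _ hϖ0) (zpow_ne_zero _ hϖ0), rfl, ?_⟩
  refine DoubleCoset.mem_doubleCoset.2 ⟨k₁, hk₁, k₂, hk₂, Units.ext ?_⟩
  rw [Units.val_mul, Units.val_mul, coe_diagUnit]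
  exact hfac

end Cartan

end Summit.Ventures.HodgeRepro2.Tier7.Line3.CartanDecomposition
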